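import Literature.Barriers.AtomisticToContinuum.HardDiskDeformationProfile
import Literature.Barriers.AtomisticToContinuum.HardDiskBoxGeometry
import Literature.Barriers.AtomisticToContinuum.HardDiskCutoff
import Mathlib.Data.EReal.Basic
import HarnessLib

/-!
# Richthammer's hard-core preserving generalised translation, in coordinates: definitions
# (Richthammer 2007, §5.4)

Part of the bottom-up programme for `Richthammer2007_ineq35` via `Richthammer2007_ineq58`
(`HardDiskTranslationInvarianceFinalSteps.lean`) and the abstract cell interface
`ShearCells.Admissible` (`HardDiskShearCells.lean`): the concrete translation systems.
§5.4 defines, for a configuration `X` and the box `Λ_n`, translation distance functions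
recursively: `t⁰ := τ_n(|·|)`, `m_{p⁰,τ⁰} := ⋀_{x ∈ X_{Λ_nᶜ}} m_{x,0}`, and in the `k`-th step
`t^k := t^{k-1} ∧ m_{p^{k-1},τ^{k-1}}`, `p^k :=` the point of `X_{Λ_n} ∖ {p¹,…,p^{k-1}}` minimising
`t^k` (ties: lexicographically smallest), `τ^k := t^k(p^k)`; the auxiliary function is
`m_{x',t}(x) := t` if `h_{x',t} c_f > 1/2`, else `t + h_{x',t} f_K(x - x') + ∞·1{f_K(x - x') = 1}`,
`h_{x',t} := |τ_n(|x'| - c_K) - t|` [Richthammer2007, §5.4, p. 11]; and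
`𝔗_n(X) = {x + t_{n,X}(x) e₁}` with `t_{n,X}(p^k) = τ^k`.

For the change of variables (§6.6) only the recursion ALONG A FORCED SELECTION ORDER is needed
(the "formal transformation" `T_π`): this file defines it in coordinates, for `k` thrown points
`x : Fin k → ℝ²`, a boundary condition `Y` (whose points outside `Λ_n` enter through
`m_{p⁰,τ⁰}`) and an order `π` (`π 0` is selected last, the convention of
`Literature/MeasureTheory/Lebesgue/TriangularShearSubstitution.lean`):

* `DeformData` — the parameters `ε` (enlargement, `K_ε` = open disc of radius `1 + ε`,
  `c_K = 1 + ε`), `τ`, `R`, `n`; `prof = τ_n` (the tree's `tProfile`), `baseShift = t⁰`,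
  `hAux = h_{x',t}`, `mAux = m_{x',t}` (`EReal`-valued), `outShift = m_{p⁰,τ⁰}`;
* `stageShift` — `t^k` as a function of the list of earlier pairs `(pⁱ, τⁱ)`; `stagePairs`,
  `stageTau` — the recursion along a forced sequence of positions;
* `richtShift P Y k π : Fin k → ((ℝ²)^k → ℝ)` — the translation system `t^{π(j)}_{π,x}` of
  `T_π` [Richthammer2007, §6.6 (6.21)], with `richtShift_triangular` (it is triangular in the
  order `π`, by construction) and the bounds `0 ≤ · ≤ τ` (`richtShift_mem_Icc`).

Measurability, the `1/2`-Lipschitz property along `e₁` (Lemma 16), the cells and the transfer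
properties (Lemmas 8–10, 17–21) are for the sequel files.

## References

* [Richthammer2007] T. Richthammer, *Translation-invariance of two-dimensional Gibbsian point
  processes*, Comm. Math. Phys. 274 (2007) 81–122, arXiv:0706.3637: §5.1 (p. 10), §5.2 (5.2)
  (p. 11), §5.4 (p. 11), §6.6 (6.21) (p. 16).
-/

noncomputable section

open MeasureTheory Set Function
open scoped ENNReal

namespace Literature.Barriers.AtomisticToContinuum.HardDisk

open Literature.Analysis.FunctionSpaces

/-! ### Parameters and the elementary functions of §5.1–5.4 -/

/-- **Parameters of Richthammer's construction** (§5.1–5.2): the enlargement `ε > 0` of the hard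
core (`K_ε`, (5.1)), the shift `τ ∈ [0, 1/2]`, the inner radius `R` (from Lemma 7) and the outer
box `Λ_n`, `n > R`. [cite: Richthammer2007, §5.1–5.2 (pp. 10–11)] -/
structure DeformData where
  /-- The enlargement parameter `ε`. -/
  ε : ℝ
  /-- The shift `τ`. -/
  τ : ℝ
  /-- The inner radius `R`. -/
  R : ℕ
  /-- The outer box parameter `n`. -/
  n : ℕ

namespace DeformData

variable (P : DeformData)

/-- `c_K := sup{|x| : x ∈ K_ε}`; for the Euclidean disc `K_ε = B(0, 1 + ε)` one may take
`c_K = 1 + ε` (the maximum norm is bounded by the Euclidean norm). [cite: Richthammer2007, §5.1 (5.2) (p. 10)] -/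
def cK : ℝ := 1 + P.ε

/-- The translation distance function `τ_n` (the tree's `tProfile τ R n`). [cite: Richthammer2007, §5.2 (p. 11)] -/
def prof (s : ℝ) : ℝ := tProfile P.τ P.R P.n s

/-- `t⁰ := τ_n(|·|)` (maximum norm). [cite: Richthammer2007, §5.4 (p. 11)] -/
def baseShift (y : EuclideanSpace ℝ (Fin 2)) : ℝ := P.prof (supNorm y)

/-- `h_{x',t} := |τ_n(|x'| - c_K) - t|`. [cite: Richthammer2007, §5.4 (p. 11)] -/
def hAux (x' : EuclideanSpace ℝ (Fin 2)) (t : ℝ) : ℝ := |P.prof (supNorm x' - P.cK) - t|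

/-- **The auxiliary function** `m_{x',t} : ℝ² → ℝ ∪ {+∞}`: `t` if `h_{x',t} c_f > 1/2`, else
`t + h_{x',t} f_K(x - x') + ∞ · 1{f_K(x - x') = 1}` (slows the translation down near a point
`x'` of known translation distance `t`). [cite: Richthammer2007, §5.4 (p. 11)] -/
def mAux (x' : EuclideanSpace ℝ (Fin 2)) (t : ℝ) (y : EuclideanSpace ℝ (Fin 2)) : EReal :=
  if 1 / 2 < P.hAux x' t * cF P.ε then (t : EReal)
  else if fK P.ε (y - x') = 1 then ⊤ else ((t + P.hAux x' t * fK P.ε (y - x') : ℝ) : EReal)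

/-- `m_{p⁰,τ⁰} := ⋀_{x ∈ X̄_{Λ_nᶜ}} m_{x,0}`: the constraints from the (unmoved) points of the
boundary condition outside `Λ_n`. [cite: Richthammer2007, §5.4 (p. 11)] -/
def outShift (Y : PointConfig (EuclideanSpace ℝ (Fin 2))) (y : EuclideanSpace ℝ (Fin 2)) : EReal :=
  ⨅ q : {q : EuclideanSpace ℝ (Fin 2) // q ∈ Y ∧ q ∉ box (P.n : ℝ)}, P.mAux q.1 0 y

/-- The constraints of a list of earlier pairs `(pⁱ, τⁱ)`: `⋀ᵢ m_{pⁱ,τⁱ}`. [cite: Richthammer2007, §5.4 (p. 11)] -/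
def listShift (earlier : List (EuclideanSpace ℝ (Fin 2) × ℝ)) (y : EuclideanSpace ℝ (Fin 2)) : EReal :=
  (earlier.map fun pt => P.mAux pt.1 pt.2 y).foldr (· ⊓ ·) ⊤

/-- **The `k`-th translation distance function** `t^k = t⁰ ∧ m_{p⁰,τ⁰} ∧ ⋀_{i<k} m_{pⁱ,τⁱ}`
as a function of the list of the earlier pairs `(pⁱ, τⁱ)`, `1 ≤ i < k` (real-valued: it lies
between `0` and `t⁰ ≤ τ`). [cite: Richthammer2007, §5.4 (p. 11)] -/
def stageShift (Y : PointConfig (EuclideanSpace ℝ (Fin 2)))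
    (earlier : List (EuclideanSpace ℝ (Fin 2) × ℝ)) (y : EuclideanSpace ℝ (Fin 2)) : ℝ :=
  ((P.baseShift y : EReal) ⊓ P.outShift Y y ⊓ P.listShift earlier y).toReal

/-- **The recursion along a forced sequence of positions** `p₀, p₁, …` (stage `s` = Richthammer's
step `s + 1`): the list of the pairs `(pⁱ, τⁱ)` of the stages `i < s`, with
`τⁱ = t^{i+1}(pⁱ)`. [cite: Richthammer2007, §5.4 (p. 11)] -/
def stagePairs (Y : PointConfig (EuclideanSpace ℝ (Fin 2))) (p : ℕ → EuclideanSpace ℝ (Fin 2)) :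
    ℕ → List (EuclideanSpace ℝ (Fin 2) × ℝ)
  | 0 => []
  | s + 1 => stagePairs Y p s ++ [(p s, P.stageShift Y (stagePairs Y p s) (p s))]

/-- `τ` of stage `s`: `t^{s+1}(p_s)`. [cite: Richthammer2007, §5.4 (p. 11)] -/
def stageTau (Y : PointConfig (EuclideanSpace ℝ (Fin 2))) (p : ℕ → EuclideanSpace ℝ (Fin 2))
    (s : ℕ) : ℝ :=
  P.stageShift Y (P.stagePairs Y p s) (p s)

/-! ### The translation system of the formal transformation `T_π` -/

/-- The positions in selection order: stage `s < k` selects particle `π (rev s)` (so that `π 0`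
is selected last); positions beyond `k` are irrelevant (set to `0`). [cite: Richthammer2007, §6.6 (p. 16)] -/
def posSeq {k : ℕ} (π : Equiv.Perm (Fin k)) (x : Fin k → EuclideanSpace ℝ (Fin 2)) (s : ℕ) :
    EuclideanSpace ℝ (Fin 2) :=
  if h : s < k then x (π (Fin.rev ⟨s, h⟩)) else 0

/-- The stage at which particle `l` is selected. [cite: Richthammer2007, §6.6 (p. 16)] -/
def stageOf {k : ℕ} (π : Equiv.Perm (Fin k)) (l : Fin k) : ℕ := (Fin.rev (π.symm l)).val

/-- **The translation system `t^{π(j)}_{π,x}` of the formal transformation `T_π`** (Richthammer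
2007, §6.6): particle `l`, selected at stage `s = stageOf π l`, is translated by
`t^{s+1}(x_l)`, where `t^{s+1}` is computed from the particles selected earlier.
[cite: Richthammer2007, §6.6 (6.21) (p. 16)] -/
def richtShift (Y : PointConfig (EuclideanSpace ℝ (Fin 2))) (k : ℕ) (π : Equiv.Perm (Fin k))
    (l : Fin k) (x : Fin k → EuclideanSpace ℝ (Fin 2)) : ℝ :=
  P.stageShift Y (P.stagePairs Y (posSeq π x) (stageOf π l)) (x l)

/-! ### Elementary properties -/

variable {P}

/-- `0 ≤ τ_n ≤ τ` (for `τ ≥ 0`, `R < n`). [cite: Richthammer2007, §5.2 (5.2) (p. 11)] -/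
theorem prof_mem_Icc (hτ : 0 ≤ P.τ) (hRn : P.R < P.n) (s : ℝ) : P.prof s ∈ Set.Icc 0 P.τ :=
  tProfile_mem_Icc hτ (by exact_mod_cast hRn) s

/-- `0 ≤ t⁰ ≤ τ`. [cite: Richthammer2007, §5.4 (p. 11)] -/
theorem baseShift_mem_Icc (hτ : 0 ≤ P.τ) (hRn : P.R < P.n) (y : EuclideanSpace ℝ (Fin 2)) :
    P.baseShift y ∈ Set.Icc 0 P.τ :=
  prof_mem_Icc hτ hRn _

variable (P) in
/-- `h_{x',t} ≥ 0`. [folklore] -/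
theorem hAux_nonneg (x' : EuclideanSpace ℝ (Fin 2)) (t : ℝ) : 0 ≤ P.hAux x' t := abs_nonneg _

variable (P) in
/-- `m_{x',t} ≥ t`. [cite: Richthammer2007, §6.3 (p. 13, "from `m_{x,t} ≥ t`")] -/
theorem le_mAux (x' : EuclideanSpace ℝ (Fin 2)) (t : ℝ) (y : EuclideanSpace ℝ (Fin 2)) :
    (t : EReal) ≤ P.mAux x' t y := by
  unfold mAux
  split_ifs with h1 h2
  · exact le_rfl
  · exact le_top
  · exact EReal.coe_le_coe_iff.2 (le_add_of_nonneg_right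
      (mul_nonneg (P.hAux_nonneg x' t) (fK_nonneg _ _)))

variable (P) in
/-- `m_{x',t}` is never `-∞`. [folklore] -/
theorem mAux_ne_bot (x' : EuclideanSpace ℝ (Fin 2)) (t : ℝ) (y : EuclideanSpace ℝ (Fin 2)) :
    P.mAux x' t y ≠ ⊥ :=
  ne_bot_of_gt (lt_of_lt_of_le (EReal.bot_lt_coe t) (P.le_mAux x' t y))

variable (P) in
/-- The outside constraints are nonnegative: `m_{p⁰,τ⁰} ≥ 0`. [cite: Richthammer2007, §5.4 (p. 11)] -/
theorem outShift_nonneg (Y : PointConfig (EuclideanSpace ℝ (Fin 2))) (y : EuclideanSpace ℝ (Fin 2)) :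
    (0 : EReal) ≤ P.outShift Y y :=
  le_iInf fun q => by exact_mod_cast P.le_mAux q.1 0 y

variable (P) in
/-- The constraints of earlier pairs with nonnegative `τⁱ` are nonnegative. [folklore] -/
theorem listShift_nonneg {earlier : List (EuclideanSpace ℝ (Fin 2) × ℝ)}
    (h : ∀ pt ∈ earlier, 0 ≤ pt.2) (y : EuclideanSpace ℝ (Fin 2)) : (0 : EReal) ≤ P.listShift earlier y := by
  induction earlier with
  | nil => exact le_top
  | cons pt rest ih =>
    simp only [listShift, List.map_cons, List.foldr_cons]
    refine le_inf ?_ (ih fun pt' hpt' => h pt' (List.mem_cons_of_mem _ hpt'))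
    exact le_trans (by exact_mod_cast h pt List.mem_cons_self) (P.le_mAux pt.1 pt.2 y)

/-- **`0 ≤ t^k ≤ t⁰ ≤ τ`**: the translation distance functions lie between `0` and `τ` (given
`τ ≥ 0`, `R < n` and nonnegative earlier `τⁱ`). [cite: Richthammer2007, §6.4 (6.11) (p. 14)] -/
theorem stageShift_mem_Icc (hτ : 0 ≤ P.τ) (hRn : P.R < P.n) (Y : PointConfig (EuclideanSpace ℝ (Fin 2)))
    {earlier : List (EuclideanSpace ℝ (Fin 2) × ℝ)} (h : ∀ pt ∈ earlier, 0 ≤ pt.2)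
    (y : EuclideanSpace ℝ (Fin 2)) :
    P.stageShift Y earlier y ∈ Set.Icc 0 (P.baseShift y) := by
  unfold stageShift
  set v : EReal := (P.baseShift y : EReal) ⊓ P.outShift Y y ⊓ P.listShift earlier y with hv
  have hv0 : (0 : EReal) ≤ v :=
    le_inf (le_inf (by exact_mod_cast (baseShift_mem_Icc hτ hRn y).1) (P.outShift_nonneg Y y))
      (P.listShift_nonneg h y)
  have hv1 : v ≤ (P.baseShift y : EReal) := inf_le_left.trans inf_le_left
  -- `v` is a real number in `[0, t⁰]`
  have hvtop : v ≠ ⊤ := ne_top_of_le_ne_top (EReal.coe_ne_top _) hv1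
  have hvbot : v ≠ ⊥ := ne_bot_of_le_ne_bot (EReal.coe_ne_bot 0) hv0
  obtain ⟨r, hr⟩ : ∃ r : ℝ, (r : EReal) = v := ⟨v.toReal, EReal.coe_toReal hvtop hvbot⟩
  rw [← hr, EReal.toReal_coe]
  rw [← hr] at hv0 hv1
  exact ⟨EReal.coe_le_coe_iff.1 hv0, EReal.coe_le_coe_iff.1 hv1⟩

/-- `t^k ≤ τ`. [cite: Richthammer2007, §6.4 (6.11) (p. 14)] -/
theorem stageShift_le (hτ : 0 ≤ P.τ) (hRn : P.R < P.n) (Y : PointConfig (EuclideanSpace ℝ (Fin 2)))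
    {earlier : List (EuclideanSpace ℝ (Fin 2) × ℝ)} (h : ∀ pt ∈ earlier, 0 ≤ pt.2)
    (y : EuclideanSpace ℝ (Fin 2)) : P.stageShift Y earlier y ≤ P.τ :=
  ((stageShift_mem_Icc hτ hRn Y h y).2).trans (baseShift_mem_Icc hτ hRn y).2

/-- All `τⁱ` of the recursion are nonnegative. [cite: Richthammer2007, §5.4 (5.3''): `0 =: τ⁰ ≤ τ¹ ≤ …`] -/
theorem stagePairs_nonneg (hτ : 0 ≤ P.τ) (hRn : P.R < P.n) (Y : PointConfig (EuclideanSpace ℝ (Fin 2)))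
    (p : ℕ → EuclideanSpace ℝ (Fin 2)) (s : ℕ) : ∀ pt ∈ P.stagePairs Y p s, 0 ≤ pt.2 := by
  induction s with
  | zero => simp [stagePairs]
  | succ s ih =>
    intro pt hpt
    simp only [stagePairs, List.mem_append, List.mem_singleton] at hpt
    rcases hpt with hpt | rfl
    · exact ih pt hpt
    · exact (stageShift_mem_Icc hτ hRn Y ih _).1

/-- `0 ≤ τ_s ≤ τ`. [cite: Richthammer2007, §6.4 (6.11) (p. 14)] -/
theorem stageTau_mem_Icc (hτ : 0 ≤ P.τ) (hRn : P.R < P.n) (Y : PointConfig (EuclideanSpace ℝ (Fin 2)))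
    (p : ℕ → EuclideanSpace ℝ (Fin 2)) (s : ℕ) : P.stageTau Y p s ∈ Set.Icc 0 P.τ :=
  ⟨(stageShift_mem_Icc hτ hRn Y (stagePairs_nonneg hτ hRn Y p s) _).1,
    stageShift_le hτ hRn Y (stagePairs_nonneg hτ hRn Y p s) _⟩

/-- The length of the list of earlier pairs is the stage. [folklore] -/
theorem length_stagePairs (Y : PointConfig (EuclideanSpace ℝ (Fin 2)))
    (p : ℕ → EuclideanSpace ℝ (Fin 2)) (s : ℕ) : (P.stagePairs Y p s).length = s := by
  induction s with
  | zero => rfl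
  | succ s ih => simp [stagePairs, ih]

/-- **Locality of the recursion**: the pairs of the stages `< s` only depend on the positions
`p₀, …, p_{s-1}`. [cite: Richthammer2007, §6.6 (p. 16: "`T^{π(j)}_{π,x}` only depends on those
`x_{π(l)}` such that `l ≤ j - 1`")] -/
theorem stagePairs_congr (Y : PointConfig (EuclideanSpace ℝ (Fin 2)))
    {p p' : ℕ → EuclideanSpace ℝ (Fin 2)} {s : ℕ} (h : ∀ i, i < s → p i = p' i) :
    P.stagePairs Y p s = P.stagePairs Y p' s := by
  induction s with
  | zero => rfl
  | succ s ih =>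
    have ih' := ih fun i hi => h i (Nat.lt_succ_of_lt hi)
    simp only [stagePairs, ih', h s (Nat.lt_succ_self s)]

/-- **`0 ≤ t^{π(j)}_{π,x} ≤ τ`.** [cite: Richthammer2007, §6.4 (6.11) (p. 14)] -/
theorem richtShift_mem_Icc (hτ : 0 ≤ P.τ) (hRn : P.R < P.n) (Y : PointConfig (EuclideanSpace ℝ (Fin 2)))
    (k : ℕ) (π : Equiv.Perm (Fin k)) (l : Fin k) (x : Fin k → EuclideanSpace ℝ (Fin 2)) :
    P.richtShift Y k π l x ∈ Set.Icc 0 P.τ :=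
  ⟨(stageShift_mem_Icc hτ hRn Y (stagePairs_nonneg hτ hRn Y _ _) _).1,
    stageShift_le hτ hRn Y (stagePairs_nonneg hτ hRn Y _ _) _⟩

/-- The stage of `π j` is `rev j`. [folklore] -/
theorem stageOf_apply {k : ℕ} (π : Equiv.Perm (Fin k)) (j : Fin k) :
    stageOf π (π j) = (Fin.rev j).val := by
  simp [stageOf]

/-- Earlier stages are later indices: if `i < stageOf π (π j)` and `i < k` then the particle
selected at stage `i` is `π (rev i)` with `j < rev i`. [folklore] -/
theorem lt_rev_of_lt_stageOf {k : ℕ} {j : Fin k} {i : ℕ} (hi : i < (Fin.rev j).val) (hik : i < k) :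
    j < Fin.rev ⟨i, hik⟩ := by
  rw [Fin.lt_def, Fin.val_rev]
  rw [Fin.val_rev] at hi
  simp only at hi ⊢
  omega

/-- **`richtShift` is triangular in the order `π`** (the hypothesis of
`lintegral_shearJacobian_mul_comp_shearMap_of_perm`): the translation of `π j` only depends on
the positions `x (π i)`, `i ≥ j`. [cite: Richthammer2007, §6.6 (p. 16)] -/
theorem richtShift_triangular (Y : PointConfig (EuclideanSpace ℝ (Fin 2))) (k : ℕ)
    (π : Equiv.Perm (Fin k)) (j : Fin k) (x x' : Fin k → EuclideanSpace ℝ (Fin 2))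
    (h : ∀ i, j ≤ i → x (π i) = x' (π i)) :
    P.richtShift Y k π (π j) x = P.richtShift Y k π (π j) x' := by
  unfold richtShift
  rw [h j le_rfl, stageOf_apply]
  congr 1
  refine stagePairs_congr (P := P) Y fun i hi => ?_
  have hik : i < k := lt_of_lt_of_le hi (Nat.le_of_lt_succ (by
    have := (Fin.rev j).isLt; omega))
  simp only [posSeq, dif_pos hik]
  exact h _ (lt_rev_of_lt_stageOf hi hik).le

end DeformData

end Literature.Barriers.AtomisticToContinuum.HardDisk

end
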